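import Summits.KontsevichZagierPeriods.KontsevichZagierPeriods.Theorems.LiouvilleUnfoldingAyoubPiLocalKernelRing
import Summits.KontsevichZagierPeriods.KontsevichZagierPeriods.Theorems.HurwitzMicroSectorsNormalFormPrincipleDimOneAssembly

/-!
# Item stmt-KontsevichZagierPeriods-0541, line `SketchIdeator2`: the volume form of the crux holds in
# dimension `1` (exponent `0`)

Support file (`--supports` stmt-KontsevichZagierPeriods-0541, registered stub `volumeForm_dim_one`).
By `ayoubPiLocalKernel_iff_volumeForm` (p140096) item 0541 is the `[π]`-local volume conjecture: two compact
`ℚ`-semialgebraic bodies `K₁, K₂ ⊂ ℝ^d` of equal volume satisfy `ϖ ^ N · (⟦K₁⟧ − ⟦K₂⟧) = 0` for some `N`.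
This file records the first dimension unconditionally: for `d = 1` (finite unions of intervals with real
algebraic endpoints) equal length already gives `⟦K₁⟧ = ⟦K₂⟧` (`N = 0`), as the integrand-`1` case of
Conjecture 1 in dimension `≤ 1` (`PiBox.Dlog.mem_relations_of_eval_eq_zero_of_dim_le_one`, p124986, whose
transcendence input is Baker's theorem; for volume forms only additivity of lengths and algebraic
translations are really at stake).  The first open dimension of the volume form is therefore `d = 2`, where
the volumes `∫ (g − h) dx` of bodies between two real algebraic graphs are exactly the real 1-periods
(abelian integrals with algebraic endpoints, logarithms, algebraic multiples of `π`): there the printed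
transcendence input exists (Huber–Wüstholz 2022, linear relations of 1-periods are motivic) but its
transfer into the four moves does not.  References: M. Kontsevich, D. Zagier, *Periods* (2001), §1.2;
J. Cresson, J. Viu-Sos, JTNB 34 (2022), §1; A. Huber, G. Wüstholz, *Transcendence and linear relations of
1-periods* (2022).  No definition is introduced.
-/

noncomputable section

open Set
open Literature.NumberTheory.Transcendental

namespace Summit.KontsevichZagierPeriods.LiouvilleUnfolding.NilradicalCut

open Summit.KontsevichZagierPeriods.HurwitzMicroSectors.NormalFormPrinciple.PiBox.Dlog
  (mem_relations_of_eval_eq_zero_of_dim_le_one)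

/-- A volume form (integrand `1` on its domain) has KZ's rational shape (`1 = 1 / 1`). [folklore] -/
theorem isRational_of_integrand_eq_one {n : ℕ} (K : KZ.IntegralRep n) (h1 : ∀ x ∈ K.domain, K.integrand x = 1) :
    K.IsRational :=
  ⟨1, 1, fun x _ => by simp, fun x hx => by simp [h1 x hx]⟩

/-- **Registered stub `volumeForm_dim_one` — the volume form of item 0541 in dimension `1`, with exponent
`0`.** Two one-dimensional volume forms (integrand `1` on `ℚ`-semialgebraic subsets of the line; no
compactness needed) of equal length have the same formal period. [cite: KontsevichZagier2001, §1.2 Conjecture 1] -/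
theorem volumeForm_dim_one : ∀ (K₁ K₂ : KZ.IntegralRep 1), (∀ x ∈ K₁.domain, K₁.integrand x = 1) → (∀ x ∈ K₂.domain, K₂.integrand x = 1) → K₁.value = K₂.value → KZ.toFormalPeriod (KZ.of K₁) = KZ.toFormalPeriod (KZ.of K₂) := by
  intro K₁ K₂ h₁ h₂ hv
  rw [KZ.toFormalPeriod_eq_iff]
  refine mem_relations_of_eval_eq_zero_of_dim_le_one ?_ ?_
  · refine sub_mem (AddSubgroup.subset_closure ?_) (AddSubgroup.subset_closure ?_)
    · exact ⟨1, K₁, le_rfl, isRational_of_integrand_eq_one K₁ h₁, rfl⟩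
    · exact ⟨1, K₂, le_rfl, isRational_of_integrand_eq_one K₂ h₂, rfl⟩
  · rw [map_sub, KZ.eval_of, KZ.eval_of, hv, sub_self]

/-- The `d = 1` instance of the right-hand side of `ayoubPiLocalKernel_iff_volumeForm`, unconditionally and
with `N = 0`. [cite: KontsevichZagier2001, §1.2 Conjecture 1] -/
theorem volumeForm_rhs_dim_one (K₁ K₂ : KZ.IntegralRep 1) (h₁ : ∀ x ∈ K₁.domain, K₁.integrand x = 1)
    (h₂ : ∀ x ∈ K₂.domain, K₂.integrand x = 1) (hv : K₁.value = K₂.value) :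
    ∃ N : ℕ, KZ.toFormalPeriod (KZ.of KZ.piRep) ^ N *
      (KZ.toFormalPeriod (KZ.of K₁) - KZ.toFormalPeriod (KZ.of K₂)) = 0 :=
  ⟨0, by rw [volumeForm_dim_one K₁ K₂ h₁ h₂ hv, sub_self, mul_zero]⟩

end Summit.KontsevichZagierPeriods.LiouvilleUnfolding.NilradicalCut

end
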